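import Mathlib.Algebra.Group.ConjFinite
import Mathlib.Topology.Algebra.Group.Basic
import HarnessLib

/-!
# Kottwitz 1986, §8 «Global finiteness result» — 8.1 («comes from `γ₀`») and Proposition 8.2 (pp. 390–391)

Topic `Literature/NumberTheory/Kottwitz1986` (carpet of R. E. Kottwitz, *Stable trace formula: elliptic singular terms*,
Math. Ann. 275 (1986) 365–399 [Kottwitz1986]; source of record = the GDZ Göttingen open-access digitisation
(store key `paper:url-ecbc59a1db27`, image PDF; per-page OCR `HOME/lit/lit3/g0/texts/Kottwitz1986-GDZ/p0390.txt`,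
`p0391.txt`, canvas = printed page + 6; page image `T/KOT/TK-t06/g0/Kottwitz1986-GDZ/img/p0390.jpg` read for the
displays). STATEMENTS ONLY (named facts, D-0014): no theorem, no `sorry`, no `axiom`, no `instance`, no `notation`.
Namespace `Literature.NumberTheory.Kottwitz1986.GlobalFiniteness` (squad TK file map, DEAL v1.1, 2026-09-02).

## The printed statements (p. 390)

«In this section `F` is a number field, `G` is a connected reductive group over `F`, and `ψ : G₀ → G` is an inner
twisting with `G₀` quasi-split over `F`.

**8.1.** The inner twisting `ψ` induces maps {stable classes in `G(F_v)`} → {stable classes in `G₀(F_v)`} (8.1.1)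
(see [K1]) for each place `v` of `F`. We say that the `G(𝔸)`-conjugacy class of `γ ∈ G(𝔸)` *comes from* `γ₀ ∈ G₀(F)`
if every local component of `γ` maps under (8.1.1) to the stable class of `γ₀`.

**8.2. Proposition.** Let `C` be a compact subset of `G(𝔸)`. Then there are only finitely many `G(𝔸)`-conjugacy
classes in `G(𝔸)` that meet `C` and come from some semi-simple element of `G₀(F)`.»

## What is vendored, and in which vocabulary

ONE posited datum `GlobalFinitenessData GA` (squad ruling V1: one `structure …Data`, statements as `Prop`-valued
PREDICATES on it): the adelic group `G(𝔸)` is a type PARAMETER `GA` carrying its group structure and topology as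
instance parameters (no instance is declared), so that «compact subset», «`G(𝔸)`-conjugacy class»
(`ConjClasses GA`, Mathlib) and «meets `C`» are CONCRETE; posited are the places of `F` (`Place`), the stable classes
in `G₀(F_v)` (`StClass0 v`), the map «`γ ↦` the image under (8.1.1) of the stable class of the `v`-component of
`γ`» (`locImage`), the semisimple elements of `G₀(F)` (`SS0`, field name as in the squad file `Stabilization`) and
their local stable classes (`stClass0`). Over it: `ComesFrom γ γ₀` (8.1, DEFINED from the fields) and
`Kottwitz1986_8_2`.

VACUITY / JUNK audit: no defaulted field, no `Prop`-valued field; `ComesFrom` is invariant under `G(𝔸)`-conjugacy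
only in the book's instance (the map (8.1.1) is constant on conjugacy classes) — the statement therefore speaks of
classes «that come from `γ₀`» through a representative, exactly as the print does («the `G(𝔸)`-conjugacy class of
`γ` comes from `γ₀` if every local component of `γ` …»); `Set.Finite` (no `Nat.card` junk).

## What is NOT here

The construction of (8.1.1) ([K1] = Kottwitz, *Rational conjugacy classes in reductive groups*, Duke Math. J. 49
(1982)); the proof of 8.2 (pp. 390–391: characteristic-polynomial map `G(𝔸) → GL_n(𝔸) → 𝔸ⁿ`, discreteness of
`Fⁿ`, Proposition 7.1 at almost all places, `z`-extensions for the general case).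

## References

* R. E. Kottwitz, *Stable trace formula: elliptic singular terms*, Math. Ann. 275 (1986) 365–399: §8, 8.1 and
  Proposition 8.2 (p. 390), proof pp. 390–391. [Kottwitz1986]
-/

namespace Literature.NumberTheory.Kottwitz1986.GlobalFiniteness

universe u

/-- **The data of Kottwitz's §8 AS A DATUM.** Fixed behind it (not fields): the number field `F`, the connected
reductive `F`-group `G`, the inner twisting `ψ : G₀ → G` with `G₀` quasi-split (p. 390). PARAMETER: the adelic
group `GA = G(𝔸)` with its group structure and topology (instance parameters). Fields: the places of `F`
(`Place`); the stable classes in `G₀(F_v)` (`StClass0 v`); the composite «`γ ∈ G(𝔸)` ↦ `v`-component `γ_v` ↦ its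
stable class in `G(F_v)` ↦ its image under (8.1.1)» (`locImage v γ`); the semisimple elements `γ₀ ∈ G₀(F)` (`SS0`)
and their stable classes in `G₀(F_v)` (`stClass0 v γ₀`). No field asserts a printed statement.
[cite: Kottwitz1986, §8.1 (p. 390)] -/
structure GlobalFinitenessData (GA : Type u) [Group GA] [TopologicalSpace GA] : Type (u + 1) where
  /-- the places `v` of `F` [§8.1 p. 390] -/
  Place : Type u
  /-- the stable conjugacy classes in `G₀(F_v)` [§8.1 (8.1.1) p. 390] -/
  StClass0 : Place → Type u
  /-- `γ ↦` the image under (8.1.1) «{stable classes in `G(F_v)`} → {stable classes in `G₀(F_v)`}» of the stable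
  class of the local component `γ_v` of `γ ∈ G(𝔸)` [§8.1 (8.1.1) p. 390] -/
  locImage : (v : Place) → GA → StClass0 v
  /-- the semi-simple elements `γ₀` of `G₀(F)` (name as in the squad file `Stabilization`) [§8.1 p. 390] -/
  SS0 : Type u
  /-- the stable class of `γ₀ ∈ G₀(F)` in `G₀(F_v)` [§8.1 p. 390] -/
  stClass0 : (v : Place) → SS0 → StClass0 v

namespace GlobalFinitenessData

variable {GA : Type u} [Group GA] [TopologicalSpace GA] (D : GlobalFinitenessData GA)

/-- **8.1**: «We say that the `G(𝔸)`-conjugacy class of `γ ∈ G(𝔸)` *comes from* `γ₀ ∈ G₀(F)` if every local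
component of `γ` maps under (8.1.1) to the stable class of `γ₀`» — DEFINED over the datum, on the representative
`γ`. [cite: Kottwitz1986, §8.1 (p. 390)] -/
def ComesFrom (γ : GA) (γ₀ : D.SS0) : Prop :=
  ∀ v : D.Place, D.locImage v γ = D.stClass0 v γ₀

/-- **8.2. PROPOSITION**: «Let `C` be a compact subset of `G(𝔸)`. Then there are only finitely many
`G(𝔸)`-conjugacy classes in `G(𝔸)` that meet `C` and come from some semi-simple element of `G₀(F)`.», AS A RELATION
over the datum (`ConjClasses GA` = the `G(𝔸)`-conjugacy classes; «meet `C`» = have a representative in `C`).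
[cite: Kottwitz1986, Proposition 8.2 (p. 390)] -/
def Kottwitz1986_8_2 : Prop :=
  ∀ C : Set GA, IsCompact C →
    {c : ConjClasses GA | (∃ γ ∈ C, ConjClasses.mk γ = c) ∧ ∃ γ : GA, ∃ γ₀ : D.SS0, ConjClasses.mk γ = c ∧ D.ComesFrom γ γ₀}.Finite

end GlobalFinitenessData

end Literature.NumberTheory.Kottwitz1986.GlobalFiniteness
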